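import Summits.ResolutionOfSingularities.ResolutionOfSingularities.Theorems.FrobeniusClosingSteerBetaNewtonTransportX
import Summits.ResolutionOfSingularities.ResolutionOfSingularities.Theorems.FrobeniusClosingSteerBetaSquareVisibility
import HarnessLib

/-!
# Crux `Steer` (stmt-ResolutionOfSingularities-16345), chain W4.1, β-LEAF, K-β2♭ part (II), file 10: the CLEANING TRANSFER along
# the `x`-chart letter at the origin — a cleaning dissolving the downstairs vertex `(δ − 1, γ)` lifts to a cleaning dissolving the
# upstairs face end `w⁻ = (δ − γ, γ)` (def-free)

OURS (campaign `res-hironaka`, rung L ★L-G4, slot W4.1; statements about the route's own objects; they replace the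
role of no printed item and are NOT statements of the manuscript under review [claim: Hironaka2017, status:
under-review]; AI review is weaker than expert review). Seat res-D-pv-003 (gen 7), K-β2♭ kernel owner — (II-X) C′ (`c = 0`).

* `lift_half_exponentX` — square-free bookkeeping (`a ≤ 1`, `2k + a₁ = a + b + d`): if `2c + (a₁, b, 0, 0)` is the transported
  face-vertex exponent, then `2c' + (a, b, 0, 0)` is the face-vertex exponent for an explicit `c'`.
* **`cleaning_transferX`** — along `φ y = φ x · v₁`, `φ z = φ x · z₁`, `φ w = φ x · w₁`, `f₁ · (φ x)^d = φ f`, `f ∈ 𝔪^d`,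
  `f₁ ∈ 𝔪₁^d`, `DeltaFaceGe (δ, γ) f` (`δ ≥ 1`, `γ ≥ 0`), twist `u = x^a y^b` with `a ≤ 1`, `u₁ = (φ x)^a₁ v₁^b`, `2k + a₁ = a + b + d`,
  characteristic `2`, perfect residue field upstairs:
  `(∃ q₁, BetaGt (φ x) v₁ z₁ w₁ d (δ − 1) γ (f₁ + u₁ q₁²)) → ∃ q, DeltaFaceGt x y z w d δ γ (f + u q²)`.

[cite: CossartPiltant2019, Prop. 2.1 and 2.6] [cite: CossartJannsenSaito2020, Lemma 12.1 (4)] No Theses file is imported; nothing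
here is a route item or a registration.
-/

noncomputable section

-- `Summit.<S>.<S>.…` duplicates the summit name by design (single-problem summit).
set_option linter.dupNamespace false

namespace Summit.ResolutionOfSingularities.ResolutionOfSingularities.Theorems.SwitchingDichotomy.BetaNewton

open IsLocalRing
open Literature.AlgebraicGeometry.Resolution
open Literature.AlgebraicGeometry.Resolution.CossartPiltant (uPow uPow_mem_span_uPow uPow_mem_span_uPow_of_le minExponents
  uPow_add uPow_nsmul uPow_single exists_expansion_minExponents coeff_not_mem_of_minimal)
open Summit.ResolutionOfSingularities.ResolutionOfSingularities.Theorems.SwitchingDichotomy.BetaPolygon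
open Summit.ResolutionOfSingularities.ResolutionOfSingularities.Theorems.SwitchingDichotomy.BetaLetter
  (range_four uPow_four monomial_eq_uPow threshold_le_span_uPow)

variable {S S₁ : Type} [CommRing S] [CommRing S₁]

/-! ## §1 Exponent bookkeeping -/

/-- **Square-free bookkeeping of the half-exponents, `x`-chart**: if `2c + (a₁, b, 0, 0) = L a⋆` (the transported face-vertex
exponent, `L a = (|a| − d, a₁, a₂, a₃)`), `2k + a₁ = a + b + d`, `a ≤ 1` and `|a⋆| ≥ d`, then `2c' + (a, b, 0, 0) = a⋆` for
`c' = (c₀ + d − k − c₁ − c₂ − c₃, c₁, c₂, c₃)`. [folklore] -/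
theorem lift_half_exponentX {d a b a₁ k : ℕ} (hasq : a ≤ 1) (hk : 2 * k + a₁ = a + b + d) {a' : Fin 4 → ℕ}
    (hdeg : d ≤ a' 0 + a' 1 + a' 2 + a' 3) {c : Fin 4 → ℕ}
    (hc : 2 • c + ![a₁, b, 0, 0] =
      Function.update a' 0 (∑ j ∈ (Finset.univ : Finset (Fin 4)), a' j) - d • (Pi.single 0 1 : Fin 4 → ℕ)) :
    2 • (![c 0 + d - (k + c 1 + c 2 + c 3), c 1, c 2, c 3] : Fin 4 → ℕ) + ![a, b, 0, 0] = a' := by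
  obtain ⟨e0, e1, e2, e3⟩ := transportX_apply a' d
  have k0 := congrFun hc 0; have k1 := congrFun hc 1; have k2 := congrFun hc 2; have k3 := congrFun hc 3
  simp only [Pi.add_apply, Pi.smul_apply, smul_eq_mul, Matrix.cons_val_zero, Matrix.cons_val_one,
    Matrix.cons_val] at k0 k1 k2 k3
  rw [e0] at k0; rw [e1] at k1; rw [e2] at k2; rw [e3] at k3
  funext l
  fin_cases l <;> simp <;> omega

/-! ## §2 The cleaning transfer along the `x`-chart letter -/

/-- **CLEANING TRANSFER along the `x`-chart letter at the origin.** In characteristic `2`, with a PERFECT residue field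
upstairs, along `φ y = φ x · v₁`, `φ z = φ x · z₁`, `φ w = φ x · w₁`, `f₁ · (φ x)^d = φ f`, `f ∈ 𝔪^d`, `f₁ ∈ 𝔪₁^d`,
`DeltaFaceGe (δ, γ) f` (`δ ≥ 1`, `γ ≥ 0`), with SQUARE-FREE `x`-exponent of the twist (`u = x^a y^b`, `a ≤ 1`; `u₁ = (φ x)^a₁ v₁^b`,
`2k + a₁ = a + b + d`): a cleaning `q₁` putting `f₁ + u₁ q₁²` strictly beyond the vertex `(δ − 1, γ)` lifts to a cleaning `q`
putting `f + u q²` strictly beyond the face end `(δ − γ, γ)`. [cite: CossartJannsenSaito2020, Lemma 12.1 (4)]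
[cite: CossartPiltant2019, Prop. 2.6] -/
theorem cleaning_transferX [IsLocalRing S] [CharP S 2] [IsLocalRing S₁] [CharP S₁ 2]
    (hperf : PerfectField (ResidueField S)) (φ : S →+* S₁) {x y z w : S} {v₁ z₁ w₁ : S₁}
    (ht : IsRsopPart ![x, y, z, w]) (ht' : IsRsopPart ![φ x, v₁, z₁, w₁])
    (hspan : Ideal.span {x, y, z, w} = maximalIdeal S) (hspan₁ : Ideal.span {φ x, v₁, z₁, w₁} = maximalIdeal S₁)
    (hy : φ y = φ x * v₁) (hz : φ z = φ x * z₁) (hw : φ w = φ x * w₁) {d : ℕ} {f : S} {f₁ : S₁}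
    (hfd : f ∈ maximalIdeal S ^ d) (hf : f₁ * φ x ^ d = φ f) (hf₁d : f₁ ∈ maximalIdeal S₁ ^ d)
    {δ γ : ℚ} (hδ : 1 ≤ δ) (hγ : 0 ≤ γ) (hG : DeltaFaceGe x y z w d δ γ f)
    {a b a₁ k : ℕ} (hasq : a ≤ 1) (hk : 2 * k + a₁ = a + b + d)
    (h₁ : ∃ q₁ : S₁, BetaGt (φ x) v₁ z₁ w₁ d (δ - 1) γ (f₁ + φ x ^ a₁ * v₁ ^ b * q₁ ^ 2)) :
    ∃ q : S, DeltaFaceGt x y z w d δ γ (f + x ^ a * y ^ b * q ^ 2) := by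
  classical
  haveI := ht.isRegularLocalRing
  haveI := ht'.isRegularLocalRing
  obtain ⟨q₁, hq₁⟩ := h₁
  -- expansions over the minimal exponent sets
  obtain ⟨hA, hfA, hminA⟩ := ht.minExponents_spec f
  obtain ⟨γc, hγf⟩ := exists_expansion_minExponents ![x, y, z, w] hfA
  obtain ⟨hA₁, hfA₁, hminA₁⟩ := ht'.minExponents_spec f₁
  obtain ⟨γ₁, hγ₁f⟩ := exists_expansion_minExponents ![φ x, v₁, z₁, w₁] hfA₁
  have hγ₁u := coeff_not_mem_of_minimal _ hA₁ hminA₁ hγ₁f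
  obtain ⟨hQ, hqQ, hminQ⟩ := ht'.minExponents_spec q₁
  obtain ⟨η, hηq⟩ := exists_expansion_minExponents ![φ x, v₁, z₁, w₁] hqQ
  have hηu := coeff_not_mem_of_minimal _ hQ hminQ hηq
  have hGs := forall_minExponents_of_deltaFaceGe ht (by linarith) hγ hG
  have hdegA := (mem_pow_iff_forall_minExponents ht hspan d f).mp hfd
  -- face-vertex exponents: those NOT satisfying the strict face condition
  have hvert : ∀ c ∈ minExponents ![x, y, z, w] f,
      ¬ (d ≤ c 2 + c 3 ∨ ⌊δ * ((d - c 2 - c 3 : ℕ) : ℚ)⌋₊ + 1 ≤ c 0 + c 1 ∨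
        (⌈δ * ((d - c 2 - c 3 : ℕ) : ℚ)⌉₊ ≤ c 0 + c 1 ∧ ⌊γ * ((d - c 2 - c 3 : ℕ) : ℚ)⌋₊ + 1 ≤ c 1)) →
      c 2 + c 3 < d ∧ (((c 0 + c 1 : ℕ) : ℚ) = δ * ((d - c 2 - c 3 : ℕ) : ℚ)) ∧
        ((c 1 : ℚ) = γ * ((d - c 2 - c 3 : ℕ) : ℚ)) :=
    fun c hc hPc => exponent_eq_of_faceGe_of_not_faceGt (by linarith) hγ (hGs c hc) hPc
  -- the twist exponent upstairs
  have hε : uPow ![x, y, z, w] ![a, b, 0, 0] = x ^ a * y ^ b := by rw [uPow_four]; simp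
  by_cases hex : ∃ c ∈ minExponents ![x, y, z, w] f,
      ¬ (d ≤ c 2 + c 3 ∨ ⌊δ * ((d - c 2 - c 3 : ℕ) : ℚ)⌋₊ + 1 ≤ c 0 + c 1 ∨
        (⌈δ * ((d - c 2 - c 3 : ℕ) : ℚ)⌉₊ ≤ c 0 + c 1 ∧ ⌊γ * ((d - c 2 - c 3 : ℕ) : ℚ)⌋₊ + 1 ≤ c 1))
  swap
  · -- no face vertex: `f` itself is strictly beyond the face end
    refine ⟨0, ?_⟩
    rw [zero_pow two_ne_zero, mul_zero, add_zero]
    refine deltaFaceGt_of_forall_minExponents ht δ γ fun c hc => ?_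
    by_contra hPc
    exact hex ⟨c, hc, hPc⟩
  -- the downstairs element `f₁ + u₁ q₁²` expanded, inside the downstairs strict monomial ideal
  have hε₁ : uPow ![φ x, v₁, z₁, w₁] ![a₁, b, 0, 0] = φ x ^ a₁ * v₁ ^ b := by rw [uPow_four]; simp
  have hmem : ∑ m ∈ minExponents ![φ x, v₁, z₁, w₁] f₁, γ₁ m * uPow ![φ x, v₁, z₁, w₁] m +
      ∑ c ∈ minExponents ![φ x, v₁, z₁, w₁] q₁, η c ^ 2 * uPow ![φ x, v₁, z₁, w₁] (2 • c + ![a₁, b, 0, 0]) ∈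
      Ideal.span (uPow ![φ x, v₁, z₁, w₁] ''
        {m | d ≤ m 2 + m 3 ∨ (m 2 + m 3 < d ∧ (⌊(δ - 1) * ((d - m 2 - m 3 : ℕ) : ℚ)⌋₊ + 1 ≤ m 0 ∨
          (⌈(δ - 1) * ((d - m 2 - m 3 : ℕ) : ℚ)⌉₊ ≤ m 0 ∧ ⌊γ * ((d - m 2 - m 3 : ℕ) : ℚ)⌋₊ + 1 ≤ m 1)))}) := by
    have h2 := mul_sq_expansion ![φ x, v₁, z₁, w₁] (minExponents ![φ x, v₁, z₁, w₁] q₁) η id ![a₁, b, 0, 0]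
    simp only [id] at h2
    have hexp : f₁ + φ x ^ a₁ * v₁ ^ b * q₁ ^ 2 =
        ∑ m ∈ minExponents ![φ x, v₁, z₁, w₁] f₁, γ₁ m * uPow ![φ x, v₁, z₁, w₁] m +
          ∑ c ∈ minExponents ![φ x, v₁, z₁, w₁] q₁, η c ^ 2 * uPow ![φ x, v₁, z₁, w₁] (2 • c + ![a₁, b, 0, 0]) := by
      rw [← h2, ← hηq, hε₁, ← hγ₁f]
    rw [← hexp]
    exact threshold_le_span_uPow (φ x) v₁ z₁ w₁ d
      (fun n a b => ⌊(δ - 1) * (n : ℚ)⌋₊ + 1 ≤ a ∨ (⌈(δ - 1) * (n : ℚ)⌉₊ ≤ a ∧ ⌊γ * (n : ℚ)⌋₊ + 1 ≤ b))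
      (betaGt_le_threshold (φ x) v₁ z₁ w₁ d (δ - 1) γ hq₁)
  -- every face-vertex exponent of `f` is admissible for the twist `(a, b, 0, 0)`
  have hadm : ∀ c ∈ minExponents ![x, y, z, w] f,
      ¬ (d ≤ c 2 + c 3 ∨ ⌊δ * ((d - c 2 - c 3 : ℕ) : ℚ)⌋₊ + 1 ≤ c 0 + c 1 ∨
        (⌈δ * ((d - c 2 - c 3 : ℕ) : ℚ)⌉₊ ≤ c 0 + c 1 ∧ ⌊γ * ((d - c 2 - c 3 : ℕ) : ℚ)⌋₊ + 1 ≤ c 1)) →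
      ∃ c' : Fin 4 → ℕ, 2 • c' + ![a, b, 0, 0] = c := by
    intro c hc hPc
    obtain ⟨hzw, hc01, hc1⟩ := hvert c hc hPc
    have hdeg : d ≤ c 0 + c 1 + c 2 + c 3 := by rw [← sum_four]; exact hdegA c hc
    obtain ⟨hLc, -⟩ := transport_faceVertex_mem_minExponents φ ht ht' hspan hspan₁ hy hz hw hfd hf hf₁d hδ hγ hG hc
      hzw hc01 hc1
    -- the transported exponent is the downstairs vertex exponent of `(δ − 1, γ)`
    obtain ⟨e0, e1, e2, e3⟩ := transportX_apply c d
    have hezw : (Function.update c 0 (∑ j ∈ (Finset.univ : Finset (Fin 4)), c j) - d • (Pi.single 0 1 : Fin 4 → ℕ)) 2 +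
        (Function.update c 0 (∑ j ∈ (Finset.univ : Finset (Fin 4)), c j) - d • (Pi.single 0 1 : Fin 4 → ℕ)) 3 < d := by
      rw [e2, e3]; exact hzw
    have he0 : (((Function.update c 0 (∑ j ∈ (Finset.univ : Finset (Fin 4)), c j) -
        d • (Pi.single 0 1 : Fin 4 → ℕ)) 0 : ℕ) : ℚ) = (δ - 1) * ((d -
        (Function.update c 0 (∑ j ∈ (Finset.univ : Finset (Fin 4)), c j) - d • (Pi.single 0 1 : Fin 4 → ℕ)) 2 -
        (Function.update c 0 (∑ j ∈ (Finset.univ : Finset (Fin 4)), c j) - d • (Pi.single 0 1 : Fin 4 → ℕ)) 3 : ℕ) : ℚ) := by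
      rw [e0, e2, e3]
      push_cast at hc01
      have hm : (((c 0 + c 1 + c 2 + c 3 - d : ℕ) : ℚ)) = (c 0 : ℚ) + c 1 + c 2 + c 3 - d := by
        rw [Nat.cast_sub hdeg]; push_cast; ring
      have hdm : ((d - c 2 - c 3 : ℕ) : ℚ) = (d : ℚ) - c 2 - c 3 := by
        rw [Nat.sub_sub, Nat.cast_sub (by omega)]; push_cast; ring
      rw [hm, sub_mul, one_mul, ← hc01, hdm]; ring
    have he1 : (((Function.update c 0 (∑ j ∈ (Finset.univ : Finset (Fin 4)), c j) -
        d • (Pi.single 0 1 : Fin 4 → ℕ)) 1 : ℕ) : ℚ) = γ * ((d -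
        (Function.update c 0 (∑ j ∈ (Finset.univ : Finset (Fin 4)), c j) - d • (Pi.single 0 1 : Fin 4 → ℕ)) 2 -
        (Function.update c 0 (∑ j ∈ (Finset.univ : Finset (Fin 4)), c j) - d • (Pi.single 0 1 : Fin 4 → ℕ)) 3 : ℕ) : ℚ) := by
      rw [e1, e2, e3]; exact hc1
    obtain ⟨c₀, -, hc₀⟩ := exists_two_nsmul_add_eq ht' hA₁ hγ₁u hηu ![a₁, b, 0, 0] hmem hLc
      (fun b' hb' => not_le_vertex_exponent (by linarith) hγ hezw he0 he1 hb')
    exact ⟨_, lift_half_exponentX hasq hk hdeg hc₀⟩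
  -- clean the face vertices upstairs
  obtain ⟨q, hq⟩ := exists_add_mul_sq_mem hperf ![x, y, z, w] hγf
    (fun c => ¬ (d ≤ c 2 + c 3 ∨ ⌊δ * ((d - c 2 - c 3 : ℕ) : ℚ)⌋₊ + 1 ≤ c 0 + c 1 ∨
      (⌈δ * ((d - c 2 - c 3 : ℕ) : ℚ)⌉₊ ≤ c 0 + c 1 ∧ ⌊γ * ((d - c 2 - c 3 : ℕ) : ℚ)⌋₊ + 1 ≤ c 1)))
    (fun c _ hPc => uPow_mem_deltaFaceGtIdeal x y z w d δ γ (not_not.mp hPc))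
    (fun c hc hPc s hs => by
      obtain ⟨hzw, hc01, hc1⟩ := hvert c hc hPc
      exact mul_uPow_faceVertex_mem_deltaFaceGtIdeal hspan hδ hzw hc01 hc1 hs)
    ![a, b, 0, 0] hadm
  exact ⟨q, by rw [← hε]; exact hq⟩

end Summit.ResolutionOfSingularities.ResolutionOfSingularities.Theorems.SwitchingDichotomy.BetaNewton

end
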